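import Literature.NumberTheory.Sieve.ChenShiftedAssembly
import Literature.NumberTheory.Sieve.ChenShiftedSiftedLower
import Literature.NumberTheory.Sieve.ChenShiftedSiftedDvdUpper
import Literature.NumberTheory.Sieve.ChenShiftedSwitchedSieve
import Literature.NumberTheory.Sieve.ChenShiftedSwitchedRemainder
import Literature.NumberTheory.Sieve.ChenShiftedSwitchedCount
import Literature.NumberTheory.Sieve.ChenTheoremIHolds
import HarnessLib

/-!
# Chen's Theorem II as printed — `x_h(1,2) ≥ 0.67 x C_h/(log x)²` for every even `h ≠ 0` — PROVED

This file DISCHARGES the named fact `Literature.NumberTheory.Sieve.Chen.Chen1973_theoremII` of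
`ChenTwin.lean` (Chen Jing-run, *On the representation of a larger even integer as the sum of a prime
and the product of at most two primes*, Sci. Sinica 16 (1973) 157–176, Theorem II; reprint: Wang Yuan
(ed.), *Goldbach Conjecture*, World Scientific 1984, PDF p. 150):

> for every even `h ≠ 0` and all large `x`, `x_h(1,2) ≥ 0.67 x C_h/(log x)²`,

`x_h(1,2) = #{p ≤ x : p + h = p₁ or p₂p₃}` (`shiftedPrimeAlmostPrimeCount h x`),
`C_h = ∏_{p ∣ h, p > 2} (p−1)/(p−2) ∏_{p > 2}(1 − 1/(p−1)²)` (`singularSeries h`).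

The proof is Chen's (§III, PDF p. 168: "Theorem II is proved by the same method"), assembled by
`Chen1973_theoremII_of` (`ChenShiftedAssembly`) from the weighted-sieve inequality at `z = x^{1/10}`,
`y = ⌈(x + h + 1)^{1/3}⌉` for `𝒜_h(x) = {p + h : p ≤ x}` and the three estimates

* (A) `S(𝒜_h(x), x^{1/10}) ≥ (f(5) − ε) x V_h/log x` (`roughCount_shift_tenth_lower`,
  `ChenShiftedSiftedLower`: Iwaniec's linear sieve and Bombieri–Vinogradov for the residues `−h`);
* (B) `∑_{x^{1/10} ≤ q < y} S(𝒜_h(x)_q, x^{1/10}) ≤ (∫_{1/10}^{1/3} F(5−10β)dβ/β + ε) x V_h/log x`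
  (`roughMultCount_shift_tenth_sum_upper`, `ChenShiftedSiftedDvdUpper`);
* (C) `S(B_h(x), y) ≤ ((2e^γ/5) c₁₀ + ε) x V_h/log x`, `c₁₀ = ∫_{1/10}^{1/3} log(2−3α)dα/(α(1−α))`
  (`roughCount_chenSetBShift_tenth_upper` below: the sieve step `switchedCountS_le`, the bilinear
  remainder `switchedRemainderS_le` — Nathanson's Thm 10.7, the large sieve and Siegel–Walfisz — the
  count `card_switchedTriplesS_le`, and the bridge `roughCount_chenSetBShift_le_cardS`),

with `V_h = V_h(x^{1/10}) ∼ 20 e^{−γ} C_h/log x` (`ChenSieveProductFixed`) and the numerical margin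
`20e^{−γ}(f(5) − b/2 − (e^γ/5)c₁₀) > 0.676 > 0.67` (`chen_theoremII_margin`). Every input is a theorem of
the tree; the result is unconditional. No named facts.

## References

* Chen Jing-run, Sci. Sinica 16 (1973) 157–176, Theorem II, Lemmas 8–9, §III (reprint PDF pp. 150,
  166–168). [ChenSciSinica1973]
* H. Halberstam, H.-E. Richert, *Sieve Methods* (1974), Ch. 11, Thm 11.2.
* M. B. Nathanson, *Additive Number Theory: The Classical Bases*, GTM 164 (1996), Ch. 10. [Nathanson1996]
-/

open Finset Filter Topology

noncomputable section

namespace Literature.NumberTheory.Sieve.Chen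

open ChenSieve

set_option maxHeartbeats 800000 in
/-- **Chen's Lemma 8 for the shift `h` (hypothesis (C) of `Chen1973_theoremII_of`), PROVED**: for even
`h ≠ 0` and every `ε > 0`, eventually in `x`,
`S(B_h(x), chenY) ≤ ((2e^γ/5) c₁₀ + ε) · x V_h(x^{1/10})/log x`,
`B_h(x) = {p₁p₂p₃ − h : ⌈x^{1/10}⌉ ≤ p₁ < chenY ≤ p₂ ≤ p₃, p₁p₂p₃ ≤ x + h}` (`chenSetBShift`),
`c₁₀ = switchingConstantTenth`. Combination of the bridge `roughCount_chenSetBShift_le_cardS`, the sieve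
step `switchedCountS_le` (`ε = δ = θ = t`), the remainder `switchedRemainderS_le` and the count
`card_switchedTriplesS_le` (`η = t`), with `t = min(1/8, ε/22)` (`switched_coeff_le`); the error terms
`C x/(log x)³ + (h + 1)` are absorbed into `(ε/2) · x V_h/log x ≥ (ε/2)(10/3) C₂ x/(log x)²`
(`eventually_shiftUnit_ge`). [cite: ChenSciSinica1973, Lemma 8 and §III (reprint pp. 166–168)] -/
theorem roughCount_chenSetBShift_tenth_upper {h : ℕ} (hh : Even h) (hh0 : h ≠ 0) {ε : ℝ} (hε : 0 < ε) :
    ∀ᶠ x : ℕ in atTop,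
      (roughCount (chenSetBShift h x) (chenY h x) : ℝ) ≤
        (2 * Real.exp Real.eulerMascheroniConstant / 5 * switchingConstantTenth + ε) *
          ((x : ℝ) * sieveProduct h ((x : ℝ) ^ (1 / 10 : ℝ)) / Real.log x) := by
  have hc0 : 0 ≤ switchingConstantTenth := switchingConstantTenth_nonneg
  have hc2 : switchingConstantTenth ≤ 1 / 2 := by
    have := switchingConstantTenth_lt
    norm_num at this
    linarith
  have hG0 : 0 < Real.exp Real.eulerMascheroniConstant := Real.exp_pos _
  have hG3 : Real.exp Real.eulerMascheroniConstant ≤ 3 := by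
    have h1 : Real.exp Real.eulerMascheroniConstant ≤ Real.exp 1 :=
      Real.exp_le_exp.mpr (Real.eulerMascheroniConstant_lt_two_thirds.le.trans (by norm_num))
    have h2 := Real.exp_one_lt_d9
    linarith
  have hC2 : 0 < twinPrimeConst := twinPrimeConst_pos_holds
  set t := min (1 / 8) (ε / 22) with ht
  have ht0 : 0 < t := lt_min (by norm_num) (by positivity)
  have ht8 : t ≤ 1 / 8 := min_le_left _ _
  have ht22 : 22 * t ≤ ε := by
    have := min_le_right (1 / 8 : ℝ) (ε / 22)
    rw [← ht] at this
    linarith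
  have ht1 : t ≤ 1 := by linarith
  have ht4 : t ≤ 1 / 4 := by linarith
  have h12 : 0 < 1 - 2 * t := by linarith
  have hS := switchedCountS_le hh hh0 (ε := t) (δ := t) (θ := t) ht0 ht1 ht0 ht8 ht0
  have hT := card_switchedTriplesS_le (h := h) (ε := t) ht0 ht1 (η := t) ht0
  obtain ⟨C, hR⟩ := switchedRemainderS_le hh0 (ε := t) (δ := t) ht0 ht1 ht0 ht4
  have hunit := eventually_shiftUnit_ge hh hh0 (show (0 : ℝ) < 1 / 2 by norm_num)
  -- the absorption constants: `c₀ = (ε/4)(10/3) C₂`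
  set c₀ : ℝ := ε / 4 * (10 / 3 * twinPrimeConst) with hc₀
  have hc₀0 : 0 < c₀ := by positivity
  have hjunk := eventually_rpow_le_mul_div_log_sq (θ := 1 / 2) (K := (h : ℝ) + 1) (c := c₀)
    (by norm_num) hc₀0
  have hz : ∀ᶠ x : ℕ in atTop, (2 * h : ℝ) < (x : ℝ) ^ (1 / 10 : ℝ) :=
    ((tendsto_rpow_atTop (by norm_num : (0 : ℝ) < 1 / 10)).comp
      tendsto_natCast_atTop_atTop).eventually_gt_atTop _
  have hhalf : ∀ᶠ x : ℕ in atTop, (h : ℝ) + 1 ≤ (x : ℝ) ^ (1 / 2 : ℝ) :=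
    ((tendsto_rpow_atTop (by norm_num : (0 : ℝ) < 1 / 2)).comp
      tendsto_natCast_atTop_atTop).eventually_ge_atTop _
  have hlog : Tendsto (fun N : ℕ => Real.log N) atTop atTop :=
    Real.tendsto_log_atTop.comp (tendsto_natCast_atTop_atTop (R := ℝ))
  filter_upwards [hS, hT, hR, hunit, hjunk, hz, hhalf, hlog.eventually_ge_atTop (|C| / c₀ + 1),
    eventually_ge_atTop 2] with x hSx hTx hRx hux hjx hzx hhx hLx hx2
  have hx1 : (1 : ℝ) < x := by exact_mod_cast (show 1 < x by omega)
  have hx0 : (0 : ℝ) < x := by linarith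
  have hL : 0 < Real.log x := Real.log_pos hx1
  have hV0 : 0 ≤ sieveProduct h ((x : ℝ) ^ (1 / 10 : ℝ)) := (sieveProduct_mem_Icc hh _).1
  -- the unit `W` and its lower bound `(10/3) C₂ x/(log x)² ≤ W`
  set W : ℝ := (x : ℝ) * sieveProduct h ((x : ℝ) ^ (1 / 10 : ℝ)) / Real.log x with hW
  have heγ : 1 / 3 ≤ Real.exp (-Real.eulerMascheroniConstant) := by
    have h1 := Real.add_one_le_exp (-Real.eulerMascheroniConstant)
    have h2 := Real.eulerMascheroniConstant_lt_two_thirds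
    linarith
  have hSS := singularSeries_pos h
  have hC2S : twinPrimeConst ≤ singularSeries h := twinPrimeConst_le_singularSeries h
  have hWlow : 10 / 3 * twinPrimeConst * x / Real.log x ^ 2 ≤ W := by
    have hux' : (1 - 1 / 2) * (20 * Real.exp (-Real.eulerMascheroniConstant) *
        (singularSeries h * x / Real.log x ^ 2)) ≤ W := hux
    have hQ : 0 ≤ (x : ℝ) / Real.log x ^ 2 := by positivity
    have h1 : 10 / 3 * twinPrimeConst ≤
        10 * Real.exp (-Real.eulerMascheroniConstant) * singularSeries h := by
      have := mul_le_mul heγ hC2S hC2.le (by positivity)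
      nlinarith
    have h2 := mul_le_mul_of_nonneg_right h1 hQ
    have e1 : 10 / 3 * twinPrimeConst * x / Real.log x ^ 2 =
        10 / 3 * twinPrimeConst * ((x : ℝ) / Real.log x ^ 2) := by ring
    have e2 : (1 - 1 / 2) * (20 * Real.exp (-Real.eulerMascheroniConstant) *
        (singularSeries h * x / Real.log x ^ 2)) =
        10 * Real.exp (-Real.eulerMascheroniConstant) * singularSeries h *
          ((x : ℝ) / Real.log x ^ 2) := by
      ring
    rw [e1]
    rw [e2] at hux'
    exact h2.trans hux'
  have hW0 : 0 ≤ W := le_trans (by positivity) hWlow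
  -- the error terms: `C x/L³ + (h + 1) ≤ (ε/2) W`
  have hQ0 : 0 ≤ (x : ℝ) / Real.log x ^ 2 := by positivity
  have herr1 : C * x / Real.log x ^ 3 ≤ c₀ * x / Real.log x ^ 2 := by
    have hL1 : |C| / c₀ + 1 ≤ Real.log x := hLx
    have hL2 : |C| ≤ c₀ * Real.log x := by
      have : |C| / c₀ ≤ Real.log x := by linarith
      rwa [div_le_iff₀ hc₀0, mul_comm] at this
    have e1 : C * x / Real.log x ^ 3 = C / Real.log x * ((x : ℝ) / Real.log x ^ 2) := by
      field_simp
    have e2 : c₀ * x / Real.log x ^ 2 = c₀ * ((x : ℝ) / Real.log x ^ 2) := by ring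
    rw [e1, e2]
    refine mul_le_mul_of_nonneg_right ?_ hQ0
    rw [div_le_iff₀ hL]
    exact (le_abs_self C).trans hL2
  have herr2 : (h : ℝ) + 1 ≤ c₀ * x / Real.log x ^ 2 := by
    have h1 : ((h : ℝ) + 1) * (x : ℝ) ^ (1 / 2 : ℝ) ≤ c₀ * x / Real.log x ^ 2 := hjx
    have h2 : (h : ℝ) + 1 ≤ ((h : ℝ) + 1) * (x : ℝ) ^ (1 / 2 : ℝ) := by
      have : (1 : ℝ) ≤ (x : ℝ) ^ (1 / 2 : ℝ) := Real.one_le_rpow hx1.le (by norm_num)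
      nlinarith
    exact h2.trans h1
  have herr : C * x / Real.log x ^ 3 + ((h : ℝ) + 1) ≤ ε / 2 * W := by
    have e : c₀ * x / Real.log x ^ 2 + c₀ * x / Real.log x ^ 2 =
        ε / 2 * (10 / 3 * twinPrimeConst * x / Real.log x ^ 2) := by
      rw [hc₀]; ring
    have hε2 : (0 : ℝ) ≤ ε / 2 := by positivity
    calc C * x / Real.log x ^ 3 + ((h : ℝ) + 1)
        ≤ c₀ * x / Real.log x ^ 2 + c₀ * x / Real.log x ^ 2 := add_le_add herr1 herr2
      _ = ε / 2 * (10 / 3 * twinPrimeConst * x / Real.log x ^ 2) := e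
      _ ≤ ε / 2 * W := mul_le_mul_of_nonneg_left hWlow hε2
  -- the bridge `S(B_h, chenY) ≤ #{t ∈ T̃ : coprime} + (h + 1)`
  have hbridge := roughCount_chenSetBShift_le_cardS (h := h) (x := x) (ε := t) ht0 hh0 hzx (by omega)
  have hbridge' : (roughCount (chenSetBShift h x) (chenY h x) : ℝ) ≤
      (#((switchedTriplesS h x t).filter fun tr : ℕ × ℕ × ℕ =>
          (tripleDist h tr).Coprime (primesProdBelow (y x))) : ℝ) + ((h : ℝ) + 1) := by
    exact_mod_cast hbridge
  -- the main term
  have hK0 : 0 ≤ 2 * Real.exp Real.eulerMascheroniConstant / (5 * (1 - 2 * t)) + t := by positivity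
  have hcoef := switched_coeff_le hG0 hG3 hc0 hc2 ht0 ht8
  have hmain : (2 * Real.exp Real.eulerMascheroniConstant / (5 * (1 - 2 * t)) + t) *
        #(switchedTriplesS h x t) * sieveProduct h ((x : ℝ) ^ (1 / 10 : ℝ)) ≤
      (2 * Real.exp Real.eulerMascheroniConstant / 5 * switchingConstantTenth + 11 * t) * W := by
    have h1 := mul_le_mul_of_nonneg_right (mul_le_mul_of_nonneg_left hTx hK0) hV0
    refine h1.trans ?_
    have e : (2 * Real.exp Real.eulerMascheroniConstant / (5 * (1 - 2 * t)) + t) *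
          ((1 + t) ^ 2 * (switchingConstantTenth + t) * x / Real.log x) *
          sieveProduct h ((x : ℝ) ^ (1 / 10 : ℝ)) =
        ((2 * Real.exp Real.eulerMascheroniConstant / (5 * (1 - 2 * t)) + t) * (1 + t) ^ 2 *
            (switchingConstantTenth + t)) * W := by
      rw [hW]; ring
    rw [e]
    exact mul_le_mul_of_nonneg_right hcoef hW0
  -- conclude, with the large atoms frozen
  have h11 : 11 * t ≤ ε / 2 := by linarith
  have hlast : 11 * t * W ≤ ε / 2 * W := mul_le_mul_of_nonneg_right h11 hW0
  set Tc : ℝ := (#((switchedTriplesS h x t).filter fun tr : ℕ × ℕ × ℕ =>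
    (tripleDist h tr).Coprime (primesProdBelow (y x))) : ℝ) with hTc
  set Tn : ℝ := (#(switchedTriplesS h x t) : ℝ) with hTn
  set R : ℝ := switchedRemainderS h x t ((x : ℝ) ^ (1 / 2 - t)) with hRdef
  set V : ℝ := sieveProduct h ((x : ℝ) ^ (1 / 10 : ℝ)) with hVdef
  set K' : ℝ := 2 * Real.exp Real.eulerMascheroniConstant / (5 * (1 - 2 * t)) + t with hK'
  set c : ℝ := 2 * Real.exp Real.eulerMascheroniConstant / 5 * switchingConstantTenth with hc
  set Sr : ℝ := (roughCount (chenSetBShift h x) (chenY h x) : ℝ) with hSr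
  set E : ℝ := C * x / Real.log x ^ 3 with hE
  clear_value Tc Tn R V K' c Sr E W
  linarith [hSx, hbridge', hmain, hRx, herr, hlast]

/-- **Chen's Theorem II, PROVED** (discharge of `Literature.NumberTheory.Sieve.Chen.Chen1973_theoremII`):
for every even `h ≠ 0` there is `x₀` with `x_h(1,2) ≥ 0.67 x C_h/(log x)²` for all even `x ≥ x₀`
(Chen, Sci. Sinica 16 (1973), Theorem II). The assembly `Chen1973_theoremII_of` fed with the proved
estimates (A) `roughCount_shift_tenth_lower`, (B) `roughMultCount_shift_tenth_sum_upper` and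
(C) `roughCount_chenSetBShift_tenth_upper`. [cite: ChenSciSinica1973, Theorem II] -/
theorem Chen1973_theoremII_holds : Chen1973_theoremII :=
  Chen1973_theoremII_of
    (fun _ hh hh0 _ hε => roughCount_shift_tenth_lower hh hh0 hε)
    (fun _ hh hh0 _ hε => roughMultCount_shift_tenth_sum_upper hh hh0 hε)
    (fun _ hh hh0 _ hε => roughCount_chenSetBShift_tenth_upper hh hh0 hε)

end Literature.NumberTheory.Sieve.Chen
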